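import Summits.AtomisticToContinuum.HydrodynamicLimit.Theorems.InformationPercolationEngineChaosClosesEulerEnergyDistanceB
import HarnessLib

/-!
# Energy distance on `ℝ³`: conditional negative-definiteness of the Euclidean norm and stability of the equality case

Helper for the line `Sketch` of the crux `InformationPercolationEngine.ChaosClosesEuler`
(stmt-AtomisticToContinuum-15141), skeleton v13 (`Cruxes/ChaosClosesEuler/Lines/Sketch.lean`), registered stub
`stub_energyDistance`: body VERBATIM the skeleton def `EnergyDistance`: (i) `∫∫|v−w|dμdμ + ∫∫|v−w|dνdν ≤ 2∫∫|v−w|dμdν` for equal-mass finite measures with first moments; (ii) equal-mass measures with uniformly integrable second moments and small energy distance have close `ψ`-moments.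

This file contains the compactness tools — the two-sequence pair-functional limit
`tendsto_integral_integral_of_tendsto₂` (`μₙ → μ`, `νₙ → ν` weakly with convergent first absolute moments and
`|K(v,w)| ≤ D(1+‖v‖)(1+‖w‖)` give `∫∫K dνₙ dμₙ → ∫∫K dν dμ`), Chebyshev tightness of normalisations
(`measure_normalize_norm_gt_le`) and the PROKHOROV EXTRACTION `exists_tendsto_subseq` (common weakly convergent
subsequence of two sequences of finite measures with common masses in `[ρ₁, ρ₂]`, `ρ₁ > 0`, and bounded second
moments: Mathlib's `isCompact_closure_of_isTightMeasureSet` on the metrisable `ProbabilityMeasure ℝ³`, masses by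
Bolzano–Weierstrass) — and the assembly.

Conjunct (i) is helper B (`energyDistance_nonneg`: the half-space embedding of `ℝ³` into `L²(S² × ℝ)` turns the
energy distance into `π⁻¹ ∫ (F_μ - F_ν)²`).  Conjunct (ii) (`energyDistance_stability`) is proved by compactness:
were it false, there would be pairs `(μₙ, νₙ)` in the class (masses in `[ρ₁, ρ₂]`, tail schedule up to level `n`)
with energy distance `≤ 1/(n+1)` but `ψ`-moments `ε` apart; a common subsequence converges weakly, with
uniformly integrable second moments (helper A), so that first absolute moments converge and the three pair
functionals `∫∫‖v-w‖` pass to the limit: the limit pair has equal masses and energy distance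
`≤ 0`, hence coincides by the equality case (helper B, Cramér–Wold via the characteristic function), contradicting the
convergence of the `ψ`-moments.

References: G. J. Székely, M. L. Rizzo, *Energy statistics: a class of statistics based on distances*, J. Statist. Plann. Inference 143 (2013) 1249–1272, Prop. 1–2; P. Billingsley, *Convergence of Probability Measures*, 2nd ed. (1999), Thm 5.1.
-/

noncomputable section

namespace Summit.AtomisticToContinuum.HydrodynamicLimit.Theorems.ChaosClosesEulerEnergyDistance

open scoped BigOperators Topology Classical MeasureTheory ENNReal InnerProductSpace
open Filter Set MeasureTheory
open Literature.MathematicalPhysics.KineticTheory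
open Literature.Analysis.FluidPDE
open Summit.AtomisticToContinuum.HydrodynamicLimit.Theses
open Summit.AtomisticToContinuum.HydrodynamicLimit.Theses.InformationPercolationEngine
open Summit.AtomisticToContinuum.HydrodynamicLimit.Theorems.EvenStressEnskog
open Summit.AtomisticToContinuum.HydrodynamicLimit.Theorems.ChaosClosesEulerWeakLimitToolkit
open scoped NNReal

/-! ## Pair functionals of two weakly convergent sequences -/

/-- **Pair functionals pass to the weak limit (two sequences).** If `μₙ → μ` and `νₙ → ν` weakly on `ℝ³` with
integrable and convergent first absolute moments, and `K` is a continuous pair kernel with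
`|K(v,w)| ≤ D (1+‖v‖)(1+‖w‖)`, then `∫∫ K dνₙ dμₙ → ∫∫ K dν dμ`. [folklore] -/
theorem tendsto_integral_integral_of_tendsto₂ {μs νs : ℕ → FiniteMeasure V3} {μ ν : FiniteMeasure V3}
    (hμ : Tendsto μs atTop (𝓝 μ)) (hν : Tendsto νs atTop (𝓝 ν))
    (h1μi : ∀ n, Integrable (fun v : V3 => ‖v‖) (μs n : Measure V3))
    (h1νi : ∀ n, Integrable (fun v : V3 => ‖v‖) (νs n : Measure V3))
    (h1μ : Integrable (fun v : V3 => ‖v‖) (μ : Measure V3))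
    (h1ν : Integrable (fun v : V3 => ‖v‖) (ν : Measure V3))
    (hμt : Tendsto (fun n => ∫ v, ‖v‖ ∂(μs n : Measure V3)) atTop (𝓝 (∫ v, ‖v‖ ∂(μ : Measure V3))))
    (hνt : Tendsto (fun n => ∫ v, ‖v‖ ∂(νs n : Measure V3)) atTop (𝓝 (∫ v, ‖v‖ ∂(ν : Measure V3))))
    {K : V3 × V3 → ℝ} (hK : Continuous K) {D : ℝ}
    (hKD : ∀ p, |K p| ≤ D * ((1 + ‖p.1‖) * (1 + ‖p.2‖))) :
    Tendsto (fun n => ∫ v, ∫ w, K (v, w) ∂(νs n : Measure V3) ∂(μs n : Measure V3)) atTop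
      (𝓝 (∫ v, ∫ w, K (v, w) ∂(ν : Measure V3) ∂(μ : Measure V3))) := by
  set wt : V3 × V3 → ℝ := fun p => D * ((1 + ‖p.1‖) * (1 + ‖p.2‖)) with hwt
  have hwc : Continuous wt := by rw [hwt]; fun_prop
  have h1i' : ∀ (ρ : Measure V3) [IsFiniteMeasure ρ], Integrable (fun v : V3 => ‖v‖) ρ →
      Integrable (fun v : V3 => 1 + ‖v‖) ρ := fun ρ _ h => (integrable_const _).add h
  have hwi : ∀ (ρ τ : Measure V3) [IsFiniteMeasure ρ] [IsFiniteMeasure τ], Integrable (fun v : V3 => ‖v‖) ρ →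
      Integrable (fun v : V3 => ‖v‖) τ → Integrable wt (ρ.prod τ) :=
    fun ρ τ _ _ hρ hτ => ((h1i' ρ hρ).mul_prod (h1i' τ hτ)).const_mul D
  have hw_eq : ∀ (ρ τ : Measure V3) [IsFiniteMeasure ρ] [IsFiniteMeasure τ],
      ∫ p, wt p ∂(ρ.prod τ) = D * ((∫ v, (1 + ‖v‖) ∂ρ) * (∫ v, (1 + ‖v‖) ∂τ)) := by
    intro ρ τ _ _
    rw [hwt, integral_const_mul]
    congr 1
    exact integral_prod_mul (μ := ρ) (ν := τ) (fun v : V3 => 1 + ‖v‖) (fun v : V3 => 1 + ‖v‖)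
  have h1e : ∀ (ρ : Measure V3) [IsFiniteMeasure ρ], Integrable (fun v : V3 => ‖v‖) ρ →
      ∫ v, (1 + ‖v‖) ∂ρ = ρ.real univ + ∫ v, ‖v‖ ∂ρ := by
    intro ρ _ h
    rw [integral_add (integrable_const _) h, integral_const, smul_eq_mul, mul_one]
  have h1μt' : Tendsto (fun n => ∫ v, (1 + ‖v‖) ∂(μs n : Measure V3)) atTop
      (𝓝 (∫ v, (1 + ‖v‖) ∂(μ : Measure V3))) := by
    rw [h1e _ h1μ]
    exact ((tendsto_real_univ hμ).add hμt).congr fun n => (h1e _ (h1μi n)).symm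
  have h1νt' : Tendsto (fun n => ∫ v, (1 + ‖v‖) ∂(νs n : Measure V3)) atTop
      (𝓝 (∫ v, (1 + ‖v‖) ∂(ν : Measure V3))) := by
    rw [h1e _ h1ν]
    exact ((tendsto_real_univ hν).add hνt).congr fun n => (h1e _ (h1νi n)).symm
  have hprod : Tendsto (fun n => (μs n).prod (νs n)) atTop (𝓝 (μ.prod ν)) := tendsto_prod_of_tendsto hμ hν
  have hwt' : Tendsto (fun n => ∫ p, wt p ∂(((μs n).prod (νs n) : FiniteMeasure (V3 × V3)) :
      Measure (V3 × V3))) atTop (𝓝 (∫ p, wt p ∂((μ.prod ν : FiniteMeasure (V3 × V3)) :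
      Measure (V3 × V3)))) := by
    simp only [FiniteMeasure.toMeasure_prod]
    rw [hw_eq]
    refine ((h1μt'.mul h1νt').const_mul D).congr fun n => ?_
    rw [hw_eq]
  have key := QuadraticTest.tendsto_integral_of_tendsto_integral_dominant
    (μs := fun n => (μs n).prod (νs n)) (ν := μ.prod ν) hprod hK hwc hKD
    (fun n => by simpa only [FiniteMeasure.toMeasure_prod] using hwi _ _ (h1μi n) (h1νi n))
    (by simpa only [FiniteMeasure.toMeasure_prod] using hwi _ _ h1μ h1ν) hwt'
  have hKi : ∀ (ρ τ : Measure V3) [IsFiniteMeasure ρ] [IsFiniteMeasure τ], Integrable (fun v : V3 => ‖v‖) ρ →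
      Integrable (fun v : V3 => ‖v‖) τ → Integrable K (ρ.prod τ) := fun ρ τ _ _ hρ hτ =>
    (hwi ρ τ hρ hτ).mono' hK.aestronglyMeasurable
      (Eventually.of_forall fun p => by rw [Real.norm_eq_abs]; exact hKD p)
  simp only [FiniteMeasure.toMeasure_prod] at key
  rw [integral_prod K (hKi _ _ h1μ h1ν)] at key
  refine key.congr fun n => ?_
  exact integral_prod K (hKi _ _ (h1μi n) (h1νi n))

/-! ## Tightness of normalisations from a second-moment bound -/

/-- **Chebyshev for normalisations**: if `|F| ≥ ρ₁ > 0` and `∫ ‖v‖² dF ≤ M₂` then the normalised measure gives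
mass at most `M₂ / (ρ₁ r²)` to `{r < ‖x‖}`. [folklore] -/
theorem measure_normalize_norm_gt_le (F : FiniteMeasure V3) {ρ₁ M₂ r : ℝ} (hρ₁ : 0 < ρ₁) (hr : 0 < r)
    (hm : ρ₁ ≤ ((F : Measure V3) univ).toReal) (h2 : Integrable (fun v : V3 => ‖v‖ ^ 2) (F : Measure V3))
    (hM : ∫ v, ‖v‖ ^ 2 ∂(F : Measure V3) ≤ M₂) :
    (F.normalize : Measure V3) {x : V3 | r < ‖x‖} ≤ ENNReal.ofReal (M₂ / (ρ₁ * r ^ 2)) := by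
  have hmass : ρ₁ ≤ (F.mass : ℝ) := by
    rwa [← FiniteMeasure.ennreal_mass, ENNReal.coe_toReal] at hm
  have hmpos : 0 < (F.mass : ℝ) := hρ₁.trans_le hmass
  have hF0 : F ≠ 0 := by
    rw [← FiniteMeasure.mass_nonzero_iff]
    intro h
    rw [h, NNReal.coe_zero] at hmpos
    exact lt_irrefl _ hmpos
  -- Chebyshev on the original measure
  have hcheb : (F : Measure V3).real {x : V3 | r < ‖x‖} ≤ M₂ / r ^ 2 := by
    have h := mul_meas_ge_le_integral_of_nonneg (Eventually.of_forall fun v => sq_nonneg ‖v‖) h2 (r ^ 2)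
    have hsub : {x : V3 | r < ‖x‖} ⊆ {x : V3 | r ^ 2 ≤ ‖x‖ ^ 2} := fun x (hx : r < ‖x‖) =>
      show r ^ 2 ≤ ‖x‖ ^ 2 from pow_le_pow_left₀ hr.le hx.le 2
    have hmono := measureReal_mono (μ := (F : Measure V3)) hsub (measure_ne_top _ _)
    rw [le_div_iff₀ (by positivity)]
    nlinarith
  rw [FiniteMeasure.toMeasure_normalize_eq_of_nonzero F hF0, Measure.smul_apply, ENNReal.smul_def, smul_eq_mul,
    ← ofReal_measureReal (measure_ne_top _ _)]
  have hinv : ((F.mass⁻¹ : ℝ≥0) : ℝ≥0∞) ≤ ENNReal.ofReal ρ₁⁻¹ := by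
    rw [← ENNReal.ofReal_coe_nnreal, NNReal.coe_inv]
    exact ENNReal.ofReal_le_ofReal (inv_anti₀ hρ₁ hmass)
  calc ((F.mass⁻¹ : ℝ≥0) : ℝ≥0∞) * ENNReal.ofReal ((F : Measure V3).real {x : V3 | r < ‖x‖})
      ≤ ENNReal.ofReal ρ₁⁻¹ * ENNReal.ofReal (M₂ / r ^ 2) :=
        mul_le_mul' hinv (ENNReal.ofReal_le_ofReal hcheb)
    _ = ENNReal.ofReal (M₂ / (ρ₁ * r ^ 2)) := by
        rw [← ENNReal.ofReal_mul (inv_nonneg.2 hρ₁.le)]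
        congr 1
        field_simp

/-! ## Prokhorov extraction -/

/-- **Common weakly convergent subsequence.** Two sequences of finite measures on `ℝ³` with the same masses in
`[ρ₁, ρ₂]`, `ρ₁ > 0`, and second moments bounded by `M₂` admit a common subsequence along which both converge
weakly (Prokhorov for the tight normalisations on the metrisable space of probability measures, Bolzano–Weierstrass
for the masses). [folklore] -/
theorem exists_tendsto_subseq {Fμ Fν : ℕ → FiniteMeasure V3} {ρ₁ ρ₂ M₂ : ℝ} (hρ₁ : 0 < ρ₁)
    (hm1 : ∀ n, ρ₁ ≤ ((Fμ n : Measure V3) univ).toReal) (hm2 : ∀ n, ((Fμ n : Measure V3) univ).toReal ≤ ρ₂)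
    (hmeq : ∀ n, (Fμ n : Measure V3) univ = (Fν n : Measure V3) univ)
    (h2μ : ∀ n, Integrable (fun v : V3 => ‖v‖ ^ 2) (Fμ n : Measure V3))
    (h2ν : ∀ n, Integrable (fun v : V3 => ‖v‖ ^ 2) (Fν n : Measure V3))
    (hMμ : ∀ n, ∫ v, ‖v‖ ^ 2 ∂(Fμ n : Measure V3) ≤ M₂) (hMν : ∀ n, ∫ v, ‖v‖ ^ 2 ∂(Fν n : Measure V3) ≤ M₂) :
    ∃ φ : ℕ → ℕ, StrictMono φ ∧ ∃ μ ν : FiniteMeasure V3,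
      Tendsto (Fμ ∘ φ) atTop (𝓝 μ) ∧ Tendsto (Fν ∘ φ) atTop (𝓝 ν) := by
  have hmassν : ∀ n, (Fν n).mass = (Fμ n).mass := fun n => by
    apply ENNReal.coe_injective
    rw [FiniteMeasure.ennreal_mass, FiniteMeasure.ennreal_mass, hmeq n]
  have hm1ν : ∀ n, ρ₁ ≤ ((Fν n : Measure V3) univ).toReal := fun n => by rw [← hmeq n]; exact hm1 n
  -- tightness of the normalisations
  set S : Set (ProbabilityMeasure V3) :=
    Set.range (fun n => (Fμ n).normalize) ∪ Set.range (fun n => (Fν n).normalize) with hS_def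
  have hS : IsTightMeasureSet {((P : ProbabilityMeasure V3) : Measure V3) | P ∈ S} := by
    refine isTightMeasureSet_of_tendsto_measure_norm_gt ?_
    have hb : ∀ r : ℝ, 0 < r → (⨆ ρ ∈ {((P : ProbabilityMeasure V3) : Measure V3) | P ∈ S},
        ρ {x : V3 | r < ‖x‖}) ≤ ENNReal.ofReal (M₂ / (ρ₁ * r ^ 2)) := by
      intro r hr
      refine iSup₂_le fun ρ hρ => ?_
      obtain ⟨P, hP, rfl⟩ := hρ
      rcases hP with ⟨n, rfl⟩ | ⟨n, rfl⟩
      · exact measure_normalize_norm_gt_le (Fμ n) hρ₁ hr (hm1 n) (h2μ n) (hMμ n)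
      · exact measure_normalize_norm_gt_le (Fν n) hρ₁ hr (hm1ν n) (h2ν n) (hMν n)
    have h0 : Tendsto (fun r : ℝ => ENNReal.ofReal (M₂ / (ρ₁ * r ^ 2))) atTop (𝓝 0) := by
      rw [← ENNReal.ofReal_zero]
      refine ENNReal.tendsto_ofReal (tendsto_const_nhds.div_atTop ?_)
      exact (tendsto_pow_atTop two_ne_zero).const_mul_atTop hρ₁
    refine tendsto_of_tendsto_of_tendsto_of_le_of_le' tendsto_const_nhds h0
      (Eventually.of_forall fun r => bot_le) ?_
    filter_upwards [eventually_gt_atTop 0] with r hr using hb r hr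
  have hK : IsCompact (closure S) := isCompact_closure_of_isTightMeasureSet hS
  -- the masses live in a compact interval of `ℝ≥0`
  have hIcc : ∀ n, (Fμ n).mass ∈ Icc ρ₁.toNNReal ρ₂.toNNReal := fun n => by
    have h1 : ρ₁ ≤ ((Fμ n).mass : ℝ) := by
      have := hm1 n; rwa [← FiniteMeasure.ennreal_mass, ENNReal.coe_toReal] at this
    have h2 : ((Fμ n).mass : ℝ) ≤ ρ₂ := by
      have := hm2 n; rwa [← FiniteMeasure.ennreal_mass, ENNReal.coe_toReal] at this
    exact ⟨Real.toNNReal_le_iff_le_coe.2 h1, (Real.le_toNNReal_iff_coe_le (hρ₁.le.trans (h1.trans h2))).2 h2⟩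
  -- extraction in the compact metrisable space `(PM × PM) × ℝ≥0`
  set x : ℕ → (ProbabilityMeasure V3 × ProbabilityMeasure V3) × ℝ≥0 :=
    fun n => (((Fμ n).normalize, (Fν n).normalize), (Fμ n).mass) with hx_def
  have hx : ∀ n, x n ∈ (closure S ×ˢ closure S) ×ˢ Icc ρ₁.toNNReal ρ₂.toNNReal := fun n =>
    ⟨⟨subset_closure (Or.inl ⟨n, rfl⟩), subset_closure (Or.inr ⟨n, rfl⟩)⟩, hIcc n⟩
  obtain ⟨a, -, φ, hφ, hlim⟩ := ((hK.prod hK).prod isCompact_Icc).tendsto_subseq hx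
  have hP : Tendsto (fun k => (Fμ (φ k)).normalize) atTop (𝓝 a.1.1) := hlim.fst_nhds.fst_nhds
  have hQ : Tendsto (fun k => (Fν (φ k)).normalize) atTop (𝓝 a.1.2) := hlim.fst_nhds.snd_nhds
  have hM : Tendsto (fun k => (Fμ (φ k)).mass) atTop (𝓝 a.2) := hlim.snd_nhds
  refine ⟨φ, hφ, a.2 • a.1.1.toFiniteMeasure, a.2 • a.1.2.toFiniteMeasure, ?_, ?_⟩
  · exact (tendsto_smul_toFiniteMeasure hP hM).congr fun k =>
      (FiniteMeasure.self_eq_mass_smul_normalize (Fμ (φ k))).symm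
  · refine (tendsto_smul_toFiniteMeasure hQ hM).congr fun k => ?_
    rw [← hmassν]
    exact (FiniteMeasure.self_eq_mass_smul_normalize (Fν (φ k))).symm

/-! ## Conjunct (ii): stability by compactness -/

/-- A uniform second-moment bound from the first tail level: `∫‖v‖² ≤ L²|ρ| + ∫_{L<‖v‖}‖v‖²`. [folklore] -/
theorem integral_sq_le_of_tail (ρ : Measure V3) [IsFiniteMeasure ρ] (h2 : Integrable (fun v : V3 => ‖v‖ ^ 2) ρ)
    (L : ℝ) : ∫ v, ‖v‖ ^ 2 ∂ρ ≤ L ^ 2 * ρ.real univ + ∫ v in {v : V3 | L < ‖v‖}, ‖v‖ ^ 2 ∂ρ := by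
  obtain ⟨-, he, htl⟩ := integral_sq_trunc h2 L
  have hb : ∫ v, min (‖v‖ ^ 2) (L ^ 2) ∂ρ ≤ L ^ 2 * ρ.real univ := by
    calc ∫ v, min (‖v‖ ^ 2) (L ^ 2) ∂ρ ≤ ∫ _v, L ^ 2 ∂ρ :=
          integral_mono (integrable_of_measurable_abs_le
            (by fun_prop : Continuous fun v : V3 => min (‖v‖ ^ 2) (L ^ 2)).measurable (B := L ^ 2) fun v => by
              rw [abs_of_nonneg (le_min (sq_nonneg _) (sq_nonneg _))]; exact min_le_right _ _)
            (integrable_const _) fun v => min_le_right _ _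
      _ = L ^ 2 * ρ.real univ := by rw [integral_const, smul_eq_mul, mul_comm]
  linarith

/-- **Conjunct (ii): stability of the equality case of the energy distance** over the class of pairs of finite
measures on `ℝ³` with equal masses in `[ρ₁, ρ₂]`, `ρ₁ > 0`, and second moments uniformly integrable along the tail
schedule `Lt`: small energy distance forces close `ψ`-moments for every bounded continuous `ψ` (by contradiction:
Prokhorov extraction, continuity of the energy distance under weak convergence with uniformly integrable second
moments, and the equality case `ℰ(μ,ν) = 0 ⇒ μ = ν`). [cite: SzekelyRizzo2013, Prop. 2] -/
theorem energyDistance_stability (Lt : ℕ → ℝ) (ρ₁ ρ₂ : ℝ) (hρ₁ : 0 < ρ₁) (ψ : V3 → ℝ) (hψ : Continuous ψ)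
    (hC : ∃ C : ℝ, ∀ v, |ψ v| ≤ C) (ε : ℝ) (hε : 0 < ε) :
    ∃ n : ℕ, ∃ δ : ℝ, 0 < δ ∧ ∀ μ ν : Measure V3, IsFiniteMeasure μ → IsFiniteMeasure ν →
      Integrable (fun v : V3 => ‖v‖ ^ 2) μ → Integrable (fun v : V3 => ‖v‖ ^ 2) ν →
      μ Set.univ = ν Set.univ → ρ₁ ≤ (μ Set.univ).toReal → (μ Set.univ).toReal ≤ ρ₂ →
      (∀ j : ℕ, j ≤ n → (∫ v in {v : V3 | Lt j < ‖v‖}, ‖v‖ ^ 2 ∂μ ≤ 1 / ((j : ℝ) + 1)) ∧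
        (∫ v in {v : V3 | Lt j < ‖v‖}, ‖v‖ ^ 2 ∂ν ≤ 1 / ((j : ℝ) + 1))) →
      2 * (∫ v, ∫ w, ‖v - w‖ ∂ν ∂μ) - (∫ v, ∫ w, ‖v - w‖ ∂μ ∂μ) - (∫ v, ∫ w, ‖v - w‖ ∂ν ∂ν) ≤ δ →
      |(∫ v, ψ v ∂μ) - ∫ v, ψ v ∂ν| ≤ ε := by
  obtain ⟨C, hC⟩ := hC
  by_contra! H
  choose μs νs hfμ hfν h2μ h2ν hmeq hm1 hm2 htail hE hgap using
    fun n : ℕ => H n (1 / ((n : ℝ) + 1)) (by positivity)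
  -- packaging as finite measures
  set Fμ : ℕ → FiniteMeasure V3 := fun n => ⟨μs n, hfμ n⟩ with hFμ
  set Fν : ℕ → FiniteMeasure V3 := fun n => ⟨νs n, hfν n⟩ with hFν
  -- a uniform bound on second moments from the tail level `j = 0`
  have ht0 : ∀ n, (∫ v in {v : V3 | Lt 0 < ‖v‖}, ‖v‖ ^ 2 ∂(μs n) ≤ 1) ∧
      (∫ v in {v : V3 | Lt 0 < ‖v‖}, ‖v‖ ^ 2 ∂(νs n) ≤ 1) := fun n => by
    have h := htail n 0 (Nat.zero_le n)
    simp only [Nat.cast_zero, zero_add, div_one] at h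
    exact h
  have hMμ : ∀ n, ∫ v, ‖v‖ ^ 2 ∂(Fμ n : Measure V3) ≤ Lt 0 ^ 2 * ρ₂ + 1 := fun n => by
    haveI := hfμ n
    have h := integral_sq_le_of_tail (μs n) (h2μ n) (Lt 0)
    have hm : (μs n).real univ ≤ ρ₂ := hm2 n
    have : Lt 0 ^ 2 * (μs n).real univ ≤ Lt 0 ^ 2 * ρ₂ := mul_le_mul_of_nonneg_left hm (sq_nonneg _)
    show ∫ v, ‖v‖ ^ 2 ∂(μs n) ≤ Lt 0 ^ 2 * ρ₂ + 1
    linarith [(ht0 n).1]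
  have hMν : ∀ n, ∫ v, ‖v‖ ^ 2 ∂(Fν n : Measure V3) ≤ Lt 0 ^ 2 * ρ₂ + 1 := fun n => by
    haveI := hfν n
    have h := integral_sq_le_of_tail (νs n) (h2ν n) (Lt 0)
    have hm : (νs n).real univ ≤ ρ₂ := by
      have := hm2 n; rwa [hmeq n] at this
    have : Lt 0 ^ 2 * (νs n).real univ ≤ Lt 0 ^ 2 * ρ₂ := mul_le_mul_of_nonneg_left hm (sq_nonneg _)
    show ∫ v, ‖v‖ ^ 2 ∂(νs n) ≤ Lt 0 ^ 2 * ρ₂ + 1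
    linarith [(ht0 n).2]
  -- Prokhorov extraction of a common weakly convergent subsequence
  obtain ⟨φ, hφ, μl, νl, hμ, hν⟩ := exists_tendsto_subseq (Fμ := Fμ) (Fν := Fν) (ρ₂ := ρ₂)
    (M₂ := Lt 0 ^ 2 * ρ₂ + 1) hρ₁ hm1 hm2 hmeq h2μ h2ν hMμ hMν
  -- uniform integrability of the second moments along the subsequence, hence moments converge
  have hUIμ : ∀ ε' : ℝ, 0 < ε' → ∃ L : ℝ, ∀ k,
      ∫ v in {v : V3 | L < ‖v‖}, ‖v‖ ^ 2 ∂((Fμ ∘ φ) k : Measure V3) ≤ ε' := fun ε' hε' =>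
    uniformIntegrable_of_schedule (ρs := fun k => μs (φ k)) (fun k => h2μ (φ k)) (Lt := Lt)
      (fun j k hjk => (htail (φ k) j (hjk.trans (hφ.id_le k))).1) hε'
  have hUIν : ∀ ε' : ℝ, 0 < ε' → ∃ L : ℝ, ∀ k,
      ∫ v in {v : V3 | L < ‖v‖}, ‖v‖ ^ 2 ∂((Fν ∘ φ) k : Measure V3) ≤ ε' := fun ε' hε' =>
    uniformIntegrable_of_schedule (ρs := fun k => νs (φ k)) (fun k => h2ν (φ k)) (Lt := Lt)
      (fun j k hjk => (htail (φ k) j (hjk.trans (hφ.id_le k))).2) hε'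
  obtain ⟨h2μl, h2tμ⟩ := sq_moment_of_tendsto hμ (fun k => h2μ (φ k)) hUIμ
  obtain ⟨h2νl, h2tν⟩ := sq_moment_of_tendsto hν (fun k => h2ν (φ k)) hUIν
  have hlin : ∀ v : V3, ‖v‖ ≤ 1 + ‖v‖ ^ 2 := fun v => by nlinarith [norm_nonneg v, sq_nonneg (‖v‖ - 1)]
  have h1i : ∀ (ρ : Measure V3) [IsFiniteMeasure ρ], Integrable (fun v : V3 => ‖v‖ ^ 2) ρ →
      Integrable (fun v : V3 => ‖v‖) ρ := fun ρ _ h =>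
    ((integrable_const (1 : ℝ)).add h).mono' continuous_norm.aestronglyMeasurable
      (Eventually.of_forall fun v => by rw [norm_norm]; exact hlin v)
  have h1tμ : Tendsto (fun k => ∫ v, ‖v‖ ∂((Fμ ∘ φ) k : Measure V3)) atTop (𝓝 (∫ v, ‖v‖ ∂(μl : Measure V3))) :=
    stub_quadraticTestConvergence atTop (Fμ ∘ φ) μl hμ (fun k => h2μ (φ k)) h2μl h2tμ (fun v => ‖v‖)
      continuous_norm ⟨1, fun v => by rw [one_mul, abs_norm]; exact hlin v⟩
  have h1tν : Tendsto (fun k => ∫ v, ‖v‖ ∂((Fν ∘ φ) k : Measure V3)) atTop (𝓝 (∫ v, ‖v‖ ∂(νl : Measure V3))) :=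
    stub_quadraticTestConvergence atTop (Fν ∘ φ) νl hν (fun k => h2ν (φ k)) h2νl h2tν (fun v => ‖v‖)
      continuous_norm ⟨1, fun v => by rw [one_mul, abs_norm]; exact hlin v⟩
  -- the three pair functionals `∫∫‖v-w‖` converge, hence so does the energy distance
  have hKc : Continuous fun p : V3 × V3 => ‖p.1 - p.2‖ := by fun_prop
  have hKD : ∀ p : V3 × V3, |‖p.1 - p.2‖| ≤ 1 * ((1 + ‖p.1‖) * (1 + ‖p.2‖)) := fun p => by
    rw [abs_norm, one_mul]
    nlinarith [norm_sub_le p.1 p.2, norm_nonneg p.1, norm_nonneg p.2,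
      mul_nonneg (norm_nonneg p.1) (norm_nonneg p.2)]
  have tMix := tendsto_integral_integral_of_tendsto₂ hμ hν (fun k => h1i _ (h2μ (φ k)))
    (fun k => h1i _ (h2ν (φ k))) (h1i _ h2μl) (h1i _ h2νl) h1tμ h1tν hKc hKD
  have tμμ := tendsto_integral_integral_of_tendsto₂ hμ hμ (fun k => h1i _ (h2μ (φ k)))
    (fun k => h1i _ (h2μ (φ k))) (h1i _ h2μl) (h1i _ h2μl) h1tμ h1tμ hKc hKD
  have tνν := tendsto_integral_integral_of_tendsto₂ hν hν (fun k => h1i _ (h2ν (φ k)))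
    (fun k => h1i _ (h2ν (φ k))) (h1i _ h2νl) (h1i _ h2νl) h1tν h1tν hKc hKD
  dsimp only at tMix tμμ tνν
  have tE := ((tMix.const_mul 2).sub tμμ).sub tνν
  have h0 : Tendsto (fun k => 1 / ((φ k : ℝ) + 1)) atTop (𝓝 0) :=
    tendsto_one_div_add_atTop_nhds_zero_nat.comp hφ.tendsto_atTop
  have hEl : 2 * (∫ v, ∫ w, ‖v - w‖ ∂(νl : Measure V3) ∂(μl : Measure V3))
      - (∫ v, ∫ w, ‖v - w‖ ∂(μl : Measure V3) ∂(μl : Measure V3))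
      - (∫ v, ∫ w, ‖v - w‖ ∂(νl : Measure V3) ∂(νl : Measure V3)) ≤ 0 :=
    le_of_tendsto_of_tendsto tE h0 (Eventually.of_forall fun k => hE (φ k))
  -- the limit pair has equal masses, hence coincides by the equality case
  have hml : (μl : Measure V3) univ = (νl : Measure V3) univ := by
    have t1 := tendsto_real_univ hμ
    have t2 := tendsto_real_univ hν
    have heq : (fun k => ((Fμ ∘ φ) k : Measure V3).real univ) = fun k => ((Fν ∘ φ) k : Measure V3).real univ := by
      funext k
      show (μs (φ k)).real univ = (νs (φ k)).real univ
      simp only [measureReal_def, hmeq]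
    rw [heq] at t1
    exact (ENNReal.toReal_eq_toReal_iff' (measure_ne_top _ _) (measure_ne_top _ _)).1 (tendsto_nhds_unique t1 t2)
  have hl : (μl : Measure V3) = νl :=
    measure_eq_of_energyDistance_le_zero _ _ (h1i _ h2μl) (h1i _ h2νl) hml hEl
  -- the `ψ`-moments converge to the same limit: contradiction
  have tψμ := QuadraticTest.tendsto_integral_of_abs_le hμ hψ hC
  have tψν := QuadraticTest.tendsto_integral_of_abs_le hν hψ hC
  have tgap := (tψμ.sub tψν).abs
  rw [hl, sub_self, abs_zero] at tgap
  obtain ⟨k, hk⟩ := (tgap.eventually (gt_mem_nhds hε)).exists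
  exact absurd (hgap (φ k)) (not_lt.2 hk.le)

/-- Registered stub `stub_energyDistance` of skeleton v13 (line `Sketch`, crux stmt-AtomisticToContinuum-15141): body VERBATIM the skeleton def `EnergyDistance`: (i) `∫∫|v−w|dμdμ + ∫∫|v−w|dνdν ≤ 2∫∫|v−w|dμdν` for equal-mass finite measures with first moments; (ii) equal-mass measures with uniformly integrable second moments and small energy distance have close `ψ`-moments. [folklore] -/
theorem stub_energyDistance :
    (∀ μ ν : Measure V3, IsFiniteMeasure μ → IsFiniteMeasure ν →
      Integrable (fun v : V3 => ‖v‖) μ → Integrable (fun v : V3 => ‖v‖) ν → μ Set.univ = ν Set.univ →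
      (∫ v, ∫ w, ‖v - w‖ ∂μ ∂μ) + (∫ v, ∫ w, ‖v - w‖ ∂ν ∂ν) ≤ 2 * ∫ v, ∫ w, ‖v - w‖ ∂ν ∂μ) ∧
    (∀ (Lt : ℕ → ℝ) (ρ₁ ρ₂ : ℝ), 0 < ρ₁ →
      ∀ ψ : V3 → ℝ, Continuous ψ → (∃ C : ℝ, ∀ v, |ψ v| ≤ C) →
      ∀ ε : ℝ, 0 < ε → ∃ n : ℕ, ∃ δ : ℝ, 0 < δ ∧ ∀ μ ν : Measure V3, IsFiniteMeasure μ → IsFiniteMeasure ν →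
      Integrable (fun v : V3 => ‖v‖ ^ 2) μ → Integrable (fun v : V3 => ‖v‖ ^ 2) ν →
      μ Set.univ = ν Set.univ → ρ₁ ≤ (μ Set.univ).toReal → (μ Set.univ).toReal ≤ ρ₂ →
      (∀ j : ℕ, j ≤ n → (∫ v in {v : V3 | Lt j < ‖v‖}, ‖v‖ ^ 2 ∂μ ≤ 1 / ((j : ℝ) + 1)) ∧
        (∫ v in {v : V3 | Lt j < ‖v‖}, ‖v‖ ^ 2 ∂ν ≤ 1 / ((j : ℝ) + 1))) →
      2 * (∫ v, ∫ w, ‖v - w‖ ∂ν ∂μ) - (∫ v, ∫ w, ‖v - w‖ ∂μ ∂μ) - (∫ v, ∫ w, ‖v - w‖ ∂ν ∂ν) ≤ δ →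
      |(∫ v, ψ v ∂μ) - ∫ v, ψ v ∂ν| ≤ ε) :=
  ⟨fun μ ν _ _ h1μ h1ν hm => energyDistance_nonneg μ ν h1μ h1ν hm,
    fun Lt ρ₁ ρ₂ hρ₁ ψ hψ hC ε hε => energyDistance_stability Lt ρ₁ ρ₂ hρ₁ ψ hψ hC ε hε⟩

end Summit.AtomisticToContinuum.HydrodynamicLimit.Theorems.ChaosClosesEulerEnergyDistance
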